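/-
COR-CM (cell pub-hodgecm2) — Track T ∕ W-B″ (ASSEMBLER DECISION #19, own-crow PROPOSAL T, mc-theta-3 (T4a–c) spec l.12038):
(T4c) THE SEMILINEAR DESCENT OF χ-COINVARIANTS — the quotient-congruence step of «conj((line i).Ω ιV χ) ≅_{ℂ[G]} (line ī).Ω ιV χ̄».
Seat prover-pub-hodgecm2-d2bridge-prove-7-g0-0, 2026-08-23.  THEOREMS ONLY, explicit binders.  The carrier involution (T4a)
and the Schrödinger-model operator law (T4b) are NOT constructed here: they enter as explicit binders `T`, `ψ`, `hTW`, `hTV`, `hχ`.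
HC_CM is NOT proved; «Δ2 BRIDGE CLOSED» is NOT claimed.
-/
import Summits.HodgeConjecture.HodgeCM.Model.LiuDictionaryInstance
import HarnessLib

/-!
# Semilinear functoriality of the `χ`-coinvariants and of the Weil central coinvariants `Ω(p, χ)`

The tree's `HodgeCM.TwistedCoinv.map ∕ mapEquiv ∕ mapEquiv_rep` (✔ `WeilCentralCoinvariants_1`) descend a `k`-LINEAR
intertwiner `T : S ≃ₗ[k] S'` to `Coinv ρW χ ≃ₗ[k] Coinv ρW' χ'`.  For the conjugation transport of the re-key (F∞ = conj ⊗ id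
is ANTILINEAR) one needs the same statement for a `σ`-SEMILINEAR `T : S ≃ₛₗ[σ] S'` (`σ = starRingEnd ℂ`), with the
characters related by `χ' ∘ ψ = σ ∘ χ` along a re-identification `ψ : H ≃ H'` of the acting groups (as matrix groups
`U(J_W)(𝔸_f) = U(−J_W)(𝔸_f)`, but the TYPES differ).

* §1 (generic, namespace `HodgeCM.TwistedCoinv`): `ker_le_comap_of_semilinear`, `exists_semilinearMap`,
  `exists_semilinearEquiv` (`∃ e : Coinv ρW χ ≃ₛₗ[σ] Coinv ρW' χ'` with `e (mk v) = mk (T v)`), and the equivariance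
  `rep_apply_of_mk` (`rep' g' (e x) = a • e (rep g x)` from `ρV' g' (T v) = a • T (ρV g v)`), via `Submodule.mapQ` and
  `LinearEquiv.ofLinear` in their semilinear forms.
* §2 (namespace `HodgeCM.WeilCoinv`): at `weilCoinv` — two compatible pair splittings `s`, `s'` of the lines `JW`, `JW'`
  over the same `(V, JV)`, a conjugate-linear carrier automorphism `T` of `𝒮((𝔸_f)^{N M})` intertwining the two finite Weil
  representations (member by member) and characters with `χ' (ψ u) = conj (χ u)` give
  `eΩ : Coinv (finPairRepW s) χ ≃ₛₗ[starRingEnd ℂ] Coinv (finPairRepW s') χ'`, `U(J_V)(𝔸_f)`-equivariant.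
* §3 (namespace `HodgeCM.Model.SplitLine`): the same for two `SplitLine`s `p`, `q` as `ℂ[↥V.adelicFin]`-modules
  `p.Ω ιV χ ≃ₛₗ[starRingEnd ℂ] q.Ω ιV χ'` with `eΩ (of g • x) = of g • eΩ x` — the socket `eΩ` of the antilinear
  transport frame (wb-5 (T0)).

[folklore: linear algebra of quotients; the Weil-representation content is in the hypotheses]  HC_CM is NOT proved.
-/

set_option autoImplicit false

noncomputable section

/-! ## §1 Generic semilinear functoriality of `Coinv ρW χ` -/

namespace HodgeCM.TwistedCoinv

section Semilinear

variable {k k₂ : Type*} [CommRing k] [CommRing k₂] {σ : k →+* k₂} {σ' : k₂ →+* k}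
variable {G G' H H' S S' : Type*} [Group G] [Group G'] [Group H] [Group H'] [AddCommGroup S] [Module k S]
  [AddCommGroup S'] [Module k₂ S']
variable (ρW : Representation k H S) (χ : H →* kˣ) (ρW' : Representation k₂ H' S') (χ' : H' →* k₂ˣ)

/-- **The relation submodule is carried into the relation submodule** by a `σ`-semilinear `T : S → S'` with
`T (ρW h v) = ρW' (ψ h) (T v)` and `χ' (ψ h) = σ (χ h)`: the generator `ρW h v − χ h • v` goes to the generator
`ρW' (ψ h) (T v) − χ' (ψ h) • T v`. [folklore] -/
theorem ker_le_comap_of_semilinear (T : S →ₛₗ[σ] S') (ψ : H → H')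
    (hT : ∀ (h : H) (v : S), T (ρW h v) = ρW' (ψ h) (T v))
    (hχ : ∀ h : H, ((χ' (ψ h) : k₂ˣ) : k₂) = σ ((χ h : kˣ) : k)) :
    ker ρW χ ≤ (ker ρW' χ').comap T := by
  rw [ker, Submodule.span_le]
  rintro _ ⟨⟨h, v⟩, rfl⟩
  rw [SetLike.mem_coe, Submodule.mem_comap]
  dsimp only
  rw [map_sub, map_smulₛₗ, hT, ← hχ]
  exact sub_mem_ker ρW' χ' (ψ h) (T v)

/-- **Semilinear functoriality of the `χ`-coinvariants** (the `→ₛₗ[σ]` form of ✔ `TwistedCoinv.map`): `T` descends to a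
`σ`-semilinear map `Coinv ρW χ → Coinv ρW' χ'` with `mk v ↦ mk (T v)`. [folklore] -/
theorem exists_semilinearMap (T : S →ₛₗ[σ] S') (ψ : H → H')
    (hT : ∀ (h : H) (v : S), T (ρW h v) = ρW' (ψ h) (T v))
    (hχ : ∀ h : H, ((χ' (ψ h) : k₂ˣ) : k₂) = σ ((χ h : kˣ) : k)) :
    ∃ f : Coinv ρW χ →ₛₗ[σ] Coinv ρW' χ', ∀ v : S, f (mk ρW χ v) = mk ρW' χ' (T v) :=
  ⟨(ker ρW χ).mapQ (ker ρW' χ') T (ker_le_comap_of_semilinear ρW χ ρW' χ' T ψ hT hχ), fun _ => rfl⟩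

/-- **Equivariance up to a scalar of ANY map given on generators by `T`** (the form of ✔ `TwistedCoinv.map_rep` that
does not care whether the descended map is linear or semilinear): if `e (mk v) = mk (T v)` and
`ρV' g' (T v) = a • T (ρV g v)` on `S`, then `rep g' (e x) = a • e (rep g x)`. [folklore] -/
theorem rep_apply_of_mk (e : Coinv ρW χ → Coinv ρW' χ') (T : S → S')
    (he : ∀ v : S, e (mk ρW χ v) = mk ρW' χ' (T v))
    (ρV : Representation k G S) (ρV' : Representation k₂ G' S')
    (hc : ∀ (g : G) (h : H), Commute (ρV g) (ρW h)) (hc' : ∀ (g' : G') (h' : H'), Commute (ρV' g') (ρW' h'))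
    {g : G} {g' : G'} {a : k₂} (hg : ∀ v : S, ρV' g' (T v) = a • T (ρV g v)) (x : Coinv ρW χ) :
    rep χ' ρV' hc' g' (e x) = a • e (rep χ ρV hc g x) := by
  obtain ⟨v, rfl⟩ := mk_surjective ρW χ x
  rw [he, rep_mk, rep_mk, he, hg, map_smul]

variable [RingHomInvPair σ σ'] [RingHomInvPair σ' σ]

/-- the intertwining hypothesis in the inverse direction along a semilinear equivalence. [folklore] -/
theorem semilinear_hyp_symm (T : S ≃ₛₗ[σ] S') (ψ : H ≃ H')
    (hT : ∀ (h : H) (v : S), T (ρW h v) = ρW' (ψ h) (T v)) (h' : H') (w : S') :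
    T.symm (ρW' h' w) = ρW (ψ.symm h') (T.symm w) := by
  apply T.injective
  rw [LinearEquiv.apply_symm_apply, hT, Equiv.apply_symm_apply, LinearEquiv.apply_symm_apply]

omit [RingHomInvPair σ' σ] in
/-- the character hypothesis in the inverse direction. [folklore] -/
theorem char_hyp_symm (ψ : H ≃ H') (hχ : ∀ h : H, ((χ' (ψ h) : k₂ˣ) : k₂) = σ ((χ h : kˣ) : k)) (h' : H') :
    ((χ (ψ.symm h') : kˣ) : k) = σ' ((χ' h' : k₂ˣ) : k₂) := by
  have h1 := hχ (ψ.symm h')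
  rw [Equiv.apply_symm_apply] at h1
  rw [h1, RingHomInvPair.comp_apply_eq]

/-- **THE SEMILINEAR DESCENT EQUIVALENCE** (the `≃ₛₗ[σ]` form of ✔ `TwistedCoinv.mapEquiv`): a `σ`-semilinear equivalence
`T : S ≃ₛₗ[σ] S'` with `T (ρW h v) = ρW' (ψ h) (T v)` along a bijection `ψ : H ≃ H'` and `χ' (ψ h) = σ (χ h)` descends to
`e : Coinv ρW χ ≃ₛₗ[σ] Coinv ρW' χ'` with `e (mk v) = mk (T v)` and `e.symm (mk w) = mk (T.symm w)`. [folklore] -/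
theorem exists_semilinearEquiv (T : S ≃ₛₗ[σ] S') (ψ : H ≃ H')
    (hT : ∀ (h : H) (v : S), T (ρW h v) = ρW' (ψ h) (T v))
    (hχ : ∀ h : H, ((χ' (ψ h) : k₂ˣ) : k₂) = σ ((χ h : kˣ) : k)) :
    ∃ e : Coinv ρW χ ≃ₛₗ[σ] Coinv ρW' χ',
      (∀ v : S, e (mk ρW χ v) = mk ρW' χ' (T v)) ∧ ∀ w : S', e.symm (mk ρW' χ' w) = mk ρW χ (T.symm w) := by
  have h₁ := ker_le_comap_of_semilinear ρW χ ρW' χ' (T : S →ₛₗ[σ] S') ψ hT hχ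
  have h₂ := ker_le_comap_of_semilinear ρW' χ' ρW χ (T.symm : S' →ₛₗ[σ'] S) ψ.symm
    (semilinear_hyp_symm ρW ρW' T ψ hT) (char_hyp_symm χ χ' ψ hχ)
  refine ⟨LinearEquiv.ofLinear ((ker ρW χ).mapQ (ker ρW' χ') (T : S →ₛₗ[σ] S') h₁)
      ((ker ρW' χ').mapQ (ker ρW χ) (T.symm : S' →ₛₗ[σ'] S) h₂) ?_ ?_, fun _ => rfl, fun _ => rfl⟩
  · refine Submodule.linearMap_qext _ (LinearMap.ext fun w => ?_)
    rw [LinearMap.comp_apply, LinearMap.comp_apply, LinearMap.id_comp, Submodule.mkQ_apply, Submodule.mapQ_apply,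
      Submodule.mapQ_apply, LinearEquiv.coe_coe, LinearEquiv.coe_coe, LinearEquiv.apply_symm_apply]
  · refine Submodule.linearMap_qext _ (LinearMap.ext fun v => ?_)
    rw [LinearMap.comp_apply, LinearMap.comp_apply, LinearMap.id_comp, Submodule.mkQ_apply, Submodule.mapQ_apply,
      Submodule.mapQ_apply, LinearEquiv.coe_coe, LinearEquiv.coe_coe, LinearEquiv.symm_apply_apply]

end Semilinear

end HodgeCM.TwistedCoinv

/-! ## §2 At the Weil central coinvariants `weilCoinv` -/

namespace HodgeCM.WeilCoinv

open Literature.NumberTheory.GelbartRogawski1991 Literature.NumberTheory.GelbartRogawski1991.UnitaryDualPair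
open Literature.NumberTheory.Automorphic Literature.NumberTheory.Weil1964
open NumberField

variable (F E : Type) [Field F] [NumberField F] [Field E] [NumberField E] [Algebra F E]
variable (c : E ≃ₐ[F] E) (N M : ℕ) {n n' : ℕ} (e : Fin N × Fin M ≃ Fin n) (e' : Fin N × Fin M ≃ Fin n')
variable (JV : Matrix (Fin N) (Fin N) E) (JW JW' : Matrix (Fin M) (Fin M) E)
variable {TV : Matrix (Fin N) (Fin N) F} {TW TW' : Matrix (Fin M) (Fin M) F}
variable [Algebra.IsQuadraticExtension F E] {δ : E} (hcδ : c δ = -δ) (hδ : δ ≠ 0) {d : F}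
  (hd : δ * δ = algebraMap F E d) (hV : TV.IsSymm) (hW : TW.IsSymm) (hW' : TW'.IsSymm) (hVd : IsUnit TV.det)
  (hWd : IsUnit TW.det) (hWd' : IsUnit TW'.det) (hJV : JV = TV.map (algebraMap F E))
  (hJW : JW = TW.map (algebraMap F E)) (hJW' : JW' = TW'.map (algebraMap F E))
  {s : UnitaryGroup.adelicPair F E c N M JV JW →* adelicMpCont F (Fin n) (adelicGram F e TV TW)}
  {s' : UnitaryGroup.adelicPair F E c N M JV JW' →* adelicMpCont F (Fin n') (adelicGram F e' TV TW')}
  (χ : UnitaryGroup.finAdelic F E c M JW →* ℂˣ) (χ' : UnitaryGroup.finAdelic F E c M JW' →* ℂˣ)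

/-- **(T4c) at `weilCoinv`: CONJUGATE-LINEAR TRANSPORT OF THE WEIL CENTRAL COINVARIANTS.**  Two compatible pair
splittings `s` (line `JW`) and `s'` (line `JW'`) over the same `(V, JV)`; a conjugate-linear automorphism `T` of the
carrier `𝒮((𝔸_f)^{N M})` [(T4a), a binder]; a re-identification `ψ : U(J_W)(𝔸_f) ≃ U(J_{W'})(𝔸_f)`; the operator laws
`T ∘ ω_f(s)(1,u) = ω_f(s')(1,ψ u) ∘ T`, `T ∘ ω_f(s)(k,1) = ω_f(s')(k,1) ∘ T` [(T4b), binders]; characters with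
`χ' (ψ u) = conj (χ u)`.  THEN there is `eΩ : Ω(s, χ) ≃ₛₗ[conj] Ω(s', χ')` with `eΩ [f] = [T f]`, `U(J_V)(𝔸_f)`-equivariant.
[folklore; cf. Liu21 Lem. D.1 (2) for the content of the hypotheses]  HC_CM is NOT proved. -/
theorem exists_weilCoinv_semilinearEquiv
    (hs : (splittingDatum F E c N M e JV JW hcδ hδ hd hV hW hVd hWd hJV hJW).IsCompatible s)
    (hs' : (splittingDatum F E c N M e' JV JW' hcδ hδ hd hV hW' hVd hWd' hJV hJW').IsCompatible s')
    (T : FinSB F (Fin N × Fin M) ≃ₛₗ[starRingEnd ℂ] FinSB F (Fin N × Fin M))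
    (ψ : UnitaryGroup.finAdelic F E c M JW ≃ UnitaryGroup.finAdelic F E c M JW')
    (hTW : ∀ (u : UnitaryGroup.finAdelic F E c M JW) (f : FinSB F (Fin N × Fin M)),
      T (finPairRepW F E c N M e JV JW hcδ hδ hd hV hW hVd hWd hJV hJW hs u f) =
        finPairRepW F E c N M e' JV JW' hcδ hδ hd hV hW' hVd hWd' hJV hJW' hs' (ψ u) (T f))
    (hTV : ∀ (g : UnitaryGroup.finAdelic F E c N JV) (f : FinSB F (Fin N × Fin M)),
      T (finPairRepV F E c N M e JV JW hcδ hδ hd hV hW hVd hWd hJV hJW hs g f) =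
        finPairRepV F E c N M e' JV JW' hcδ hδ hd hV hW' hVd hWd' hJV hJW' hs' g (T f))
    (hχ : ∀ u : UnitaryGroup.finAdelic F E c M JW, ((χ' (ψ u) : ℂˣ) : ℂ) = starRingEnd ℂ ((χ u : ℂˣ) : ℂ)) :
    ∃ eΩ : TwistedCoinv.Coinv (finPairRepW F E c N M e JV JW hcδ hδ hd hV hW hVd hWd hJV hJW hs) χ ≃ₛₗ[starRingEnd ℂ]
        TwistedCoinv.Coinv (finPairRepW F E c N M e' JV JW' hcδ hδ hd hV hW' hVd hWd' hJV hJW' hs') χ',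
      (∀ f : FinSB F (Fin N × Fin M),
          eΩ (TwistedCoinv.mk (finPairRepW F E c N M e JV JW hcδ hδ hd hV hW hVd hWd hJV hJW hs) χ f) =
            TwistedCoinv.mk (finPairRepW F E c N M e' JV JW' hcδ hδ hd hV hW' hVd hWd' hJV hJW' hs') χ' (T f)) ∧
        ∀ (g : UnitaryGroup.finAdelic F E c N JV)
          (x : TwistedCoinv.Coinv (finPairRepW F E c N M e JV JW hcδ hδ hd hV hW hVd hWd hJV hJW hs) χ),
          eΩ (weilCoinv F E c N M e JV JW hcδ hδ hd hV hW hVd hWd hJV hJW χ hs g x) =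
            weilCoinv F E c N M e' JV JW' hcδ hδ hd hV hW' hVd hWd' hJV hJW' χ' hs' g (eΩ x) := by
  obtain ⟨eΩ, he, -⟩ := TwistedCoinv.exists_semilinearEquiv _ χ _ χ' T ψ hTW hχ
  refine ⟨eΩ, he, fun g x => ?_⟩
  have key := TwistedCoinv.rep_apply_of_mk _ χ _ χ' eΩ T he
    (finPairRepV F E c N M e JV JW hcδ hδ hd hV hW hVd hWd hJV hJW hs)
    (finPairRepV F E c N M e' JV JW' hcδ hδ hd hV hW' hVd hWd' hJV hJW' hs')
    (commute_finPairRepV_finPairRepW F E c N M e JV JW hcδ hδ hd hV hW hVd hWd hJV hJW hs)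
    (commute_finPairRepV_finPairRepW F E c N M e' JV JW' hcδ hδ hd hV hW' hVd hWd' hJV hJW' hs')
    (g := g) (g' := g) (a := (1 : ℂ)) (fun f => by rw [one_smul]; exact (hTV g f).symm) x
  rw [one_smul] at key
  exact key.symm

end HodgeCM.WeilCoinv

/-! ## §3 At the cell's `SplitLine.Ω ιV χ` (two lines over the same `(V, JV, TV)`) -/

namespace HodgeCM.Model.SplitLine

open NumberField
open Literature.NumberTheory.GelbartRogawski1991 Literature.NumberTheory.GelbartRogawski1991.UnitaryDualPair
open Literature.NumberTheory.Automorphic Literature.NumberTheory.Weil1964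

variable {L : CMField} {ι₁ : (L : Type) →+* ℂ} (V : HermSpace3 L ι₁)
  {JV : Matrix (Fin 3) (Fin 3) (L : Type)} {TV : Matrix (Fin 3) (Fin 3) ↥(maximalRealSubfield (L : Type))}
  {δ : (L : Type)} {hcδ : IsCMField.complexConj (L : Type) δ = -δ} {hδ : δ ≠ 0} {d : ↥(maximalRealSubfield (L : Type))}
  {hd : δ * δ = algebraMap _ (L : Type) d} {hV : TV.IsSymm} {hVd : IsUnit TV.det}
  {hJV : JV = TV.map (algebraMap _ (L : Type))}
  (p q : SplitLine JV TV hcδ hδ hd hV hVd hJV)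
  (ιV : ↥V.adelicFin →*
    ↥(UnitaryGroup.finAdelic (↥(maximalRealSubfield (L : Type))) (L : Type) (IsCMField.complexConj (L : Type)) 3 JV))

set_option maxHeartbeats 400000 in
/-- **(T4c) THE SOCKET `eΩ` OF THE ANTILINEAR TRANSPORT FRAME**: for two lines-with-splitting `p`, `q` over the same
`(V, JV)`, a conjugate-linear carrier automorphism `T` [(T4a)] intertwining the finite Weil representations of `p.s`
and `q.s` member by member along `ψ : U(W_p)(𝔸_f) ≃ U(W_q)(𝔸_f)` [(T4b)], and characters with `χ' (ψ u) = conj (χ u)`,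
there is a CONJUGATE-LINEAR `ℂ[↥V.adelicFin]`-equivariant equivalence `eΩ : p.Ω ιV χ ≃ₛₗ[conj] q.Ω ιV χ'`, given on
generators by `[f] ↦ [T f]`. [folklore]  HC_CM is NOT proved. -/
theorem exists_Ω_semilinearEquiv (χ : p.CharW) (χ' : q.CharW)
    (T : FinSB ↥(maximalRealSubfield (L : Type)) (Fin 3 × Fin 1) ≃ₛₗ[starRingEnd ℂ]
      FinSB ↥(maximalRealSubfield (L : Type)) (Fin 3 × Fin 1))
    (ψ : ↥(UnitaryGroup.finAdelic (↥(maximalRealSubfield (L : Type))) (L : Type) (IsCMField.complexConj (L : Type)) 1 p.JW) ≃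
      ↥(UnitaryGroup.finAdelic (↥(maximalRealSubfield (L : Type))) (L : Type) (IsCMField.complexConj (L : Type)) 1 q.JW))
    (hTW : ∀ u f, T (WeilCoinv.finPairRepW (↥(maximalRealSubfield (L : Type))) (L : Type) (IsCMField.complexConj (L : Type))
        3 1 p.e JV p.JW hcδ hδ hd hV p.hW hVd p.hWd hJV p.hJW p.hs u f) =
      WeilCoinv.finPairRepW (↥(maximalRealSubfield (L : Type))) (L : Type) (IsCMField.complexConj (L : Type))
        3 1 q.e JV q.JW hcδ hδ hd hV q.hW hVd q.hWd hJV q.hJW q.hs (ψ u) (T f))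
    (hTV : ∀ g f, T (WeilCoinv.finPairRepV (↥(maximalRealSubfield (L : Type))) (L : Type) (IsCMField.complexConj (L : Type))
        3 1 p.e JV p.JW hcδ hδ hd hV p.hW hVd p.hWd hJV p.hJW p.hs g f) =
      WeilCoinv.finPairRepV (↥(maximalRealSubfield (L : Type))) (L : Type) (IsCMField.complexConj (L : Type))
        3 1 q.e JV q.JW hcδ hδ hd hV q.hW hVd q.hWd hJV q.hJW q.hs g (T f))
    (hχ : ∀ u, ((χ' (ψ u) : ℂˣ) : ℂ) = starRingEnd ℂ ((χ u : ℂˣ) : ℂ)) :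
    ∃ eΩ : p.Ω ιV χ ≃ₛₗ[starRingEnd ℂ] q.Ω ιV χ',
      (∀ f, eΩ (TwistedCoinv.mk (WeilCoinv.finPairRepW (↥(maximalRealSubfield (L : Type))) (L : Type)
            (IsCMField.complexConj (L : Type)) 3 1 p.e JV p.JW hcδ hδ hd hV p.hW hVd p.hWd hJV p.hJW p.hs) χ f) =
        TwistedCoinv.mk (WeilCoinv.finPairRepW (↥(maximalRealSubfield (L : Type))) (L : Type)
            (IsCMField.complexConj (L : Type)) 3 1 q.e JV q.JW hcδ hδ hd hV q.hW hVd q.hWd hJV q.hJW q.hs) χ' (T f)) ∧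
      ∀ (g : ↥V.adelicFin) (x : p.Ω ιV χ),
        eΩ (MonoidAlgebra.of ℂ ↥V.adelicFin g • x) = MonoidAlgebra.of ℂ ↥V.adelicFin g • eΩ x := by
  have H := TwistedCoinv.exists_semilinearEquiv (WeilCoinv.finPairRepW (↥(maximalRealSubfield (L : Type))) (L : Type) (IsCMField.complexConj (L : Type))
        3 1 p.e JV p.JW hcδ hδ hd hV p.hW hVd p.hWd hJV p.hJW p.hs) χ
    (WeilCoinv.finPairRepW (↥(maximalRealSubfield (L : Type))) (L : Type) (IsCMField.complexConj (L : Type))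
        3 1 q.e JV q.JW hcδ hδ hd hV q.hW hVd q.hWd hJV q.hJW q.hs) χ' T ψ hTW hχ
  obtain ⟨e₀, he₀, -⟩ := H
  have hrep : ∀ g y, e₀ (WeilCoinv.weilCoinv (↥(maximalRealSubfield (L : Type))) (L : Type) (IsCMField.complexConj (L : Type))
      3 1 p.e JV p.JW hcδ hδ hd hV p.hW hVd p.hWd hJV p.hJW χ p.hs g y) =
      WeilCoinv.weilCoinv (↥(maximalRealSubfield (L : Type))) (L : Type) (IsCMField.complexConj (L : Type))
        3 1 q.e JV q.JW hcδ hδ hd hV q.hW hVd q.hWd hJV q.hJW χ' q.hs g (e₀ y) := fun g y => by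
    have key := TwistedCoinv.rep_apply_of_mk _ χ _ χ' e₀ T he₀
      (WeilCoinv.finPairRepV (↥(maximalRealSubfield (L : Type))) (L : Type) (IsCMField.complexConj (L : Type))
        3 1 p.e JV p.JW hcδ hδ hd hV p.hW hVd p.hWd hJV p.hJW p.hs)
      (WeilCoinv.finPairRepV (↥(maximalRealSubfield (L : Type))) (L : Type) (IsCMField.complexConj (L : Type))
        3 1 q.e JV q.JW hcδ hδ hd hV q.hW hVd q.hWd hJV q.hJW q.hs)
      (WeilCoinv.commute_finPairRepV_finPairRepW (↥(maximalRealSubfield (L : Type))) (L : Type)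
        (IsCMField.complexConj (L : Type)) 3 1 p.e JV p.JW hcδ hδ hd hV p.hW hVd p.hWd hJV p.hJW p.hs)
      (WeilCoinv.commute_finPairRepV_finPairRepW (↥(maximalRealSubfield (L : Type))) (L : Type)
        (IsCMField.complexConj (L : Type)) 3 1 q.e JV q.JW hcδ hδ hd hV q.hW hVd q.hWd hJV q.hJW q.hs)
      (g := g) (g' := g) (a := (1 : ℂ)) (fun f => by rw [one_smul]; exact (hTV g f).symm) y
    rw [one_smul] at key
    exact key.symm
  refine ⟨e₀, fun f => he₀ f, fun g x => ?_⟩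
  show e₀ (Representation.asAlgebraHom ((WeilCoinv.weilCoinv (↥(maximalRealSubfield (L : Type))) (L : Type) (IsCMField.complexConj (L : Type))
      3 1 p.e JV p.JW hcδ hδ hd hV p.hW hVd p.hWd hJV p.hJW χ p.hs).comp ιV) (MonoidAlgebra.of ℂ _ g) x) =
    Representation.asAlgebraHom ((WeilCoinv.weilCoinv (↥(maximalRealSubfield (L : Type))) (L : Type) (IsCMField.complexConj (L : Type))
      3 1 q.e JV q.JW hcδ hδ hd hV q.hW hVd q.hWd hJV q.hJW χ' q.hs).comp ιV) (MonoidAlgebra.of ℂ _ g) (e₀ x)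
  rw [Representation.asAlgebraHom_of, Representation.asAlgebraHom_of]
  exact hrep (ιV g) x

end HodgeCM.Model.SplitLine

end
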